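import Literature.NumberTheory.EllipticCurves.HeegnerPointsKolyvaginPrimaryCebotarevKernelProofs
import Summits.BirchSwinnertonDyer.BirchSwinnertonDyer.Theorems.PrintCFramBottomClassIndexLawFiveLeBorelConjugationSqrt
import Summits.BirchSwinnertonDyer.BirchSwinnertonDyer.Theorems.PrintCFramBottomClassIndexLawFiveLeBorelUniserialTower
import Summits.BirchSwinnertonDyer.BirchSwinnertonDyer.Theorems.PrintCFramBottomClassIndexLawFiveLeHerbrandLineRestriction
import HarnessLib

/-!
# Route `PrintCFram`, crux C2 `BottomClassIndexLawFiveLe` (stmt-BirchSwinnertonDyer-20372), line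
# `eisenstein-resource-bdp-line` (stub `stub_kolyvaginUpper_borelCM_pairSum_offKrizLi`, input (γ)):
# **KOLYVAGIN VISIBILITY** — which classes a Kolyvagin prime can see: `[x, g^τ g] = (1 + ν τ)[x, g]`,
# the INVISIBLE classes (values anti-eigen under the lift of complex conjugation), the local
# consequence, and the SIGN `η_line` of complex conjugation on the line `W[𝔭]` at the Borel prime
# (cell `bsd-print-cfram`, seat `bsd-line-cfram-p1-w2` g6; helper `--supports` 20372; 0 facts, 0 defs)

HONEST FRAMING. Nothing about BSD is proved here, and nothing of the stub itself. At a Kolyvagin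
prime `ℓ` (inert in `K`, `Frob(ℓ) = Frob(∞)` on `K(E[n])`) the Frobenius of the place `λ ∣ ℓ` is a
`Γ_K`-conjugate of `g^τ g = (τ g)²` for some `g ∈ Γ_{K(E[n])}` (`τ` the lift of complex conjugation),
and a class `x` unramified at `λ` has `x_λ = 0 ⟺ [x, g^τ g] = 0` (McCallum 1991 §3 (3), tree
`mem_torsionLocalKer_iff_h1Eval_eq_zero`). For a `σ_*`-eigenclass `x` (`σ_* x = ν x`, `ν = ±1`)
the evaluation is **`[x, g^τ g] = ν τ[x, g] + [x, g]`** (`h1Eval_conjGalCMH_mul_eq_add_of_eigen`), so: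
* if EVERY value `[x, g]` is a `(−ν)`-eigenvector of `τ`, then `[x, g^τ g] = 0` for EVERY
  `g ∈ Γ_{K(E[n])}` — `x` is INVISIBLE to Kolyvagin primes (`h1Eval_conjGalCMH_mul_eq_zero_of_antiEigen`),
  and dies in `H¹(K_v, E[n])` at every place whose Frobenius is a conjugate of some `g^τ g`
  (`mem_torsionLocalKer_of_antiEigen`);
* if some value is NOT `(−ν)`-eigen, some `[x, g^τ g] ≠ 0` (`exists_h1Eval_conjGalCMH_mul_ne_zero_of_not_antiEigen`);
  the exact criterion is `forall_h1Eval_conjGalCMH_mul_eq_zero_iff_antiEigen`.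
In the surjective-image case no non-zero class is invisible (the values of `x ≠ 0` fill `E[n]`,
on which `τ` has both signs). At the Borel CM-ramified prime the values of a class form a LAYER
`W[𝔭^k]` (uniserial tower, w2 g5 p646373), complex conjugation preserves the LINE `W[𝔭] = ker μ`
(it anti-commutes with `μ = √−p`) and acts on it by a SIGN **`η_line = ±1`**
(`exists_lineSign_of_isComplexConjugation`, transported to `W(K̄)[n]` in
`torsionMap_eq_lineSign_smul`), while on the next layer `W[𝔭²] = W[p]` it is NOT a scalar
(`exists_torsionMap_ne_neg_smul_of_layer_two`). Hence (sibling file `…VisibilityLeaf`): the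
invisible classes are EXACTLY the depth-one classes of sign `ν = −η_line` — H1check §3 / LEAD g7's
«Kolyvagin blind to the wrong-sign eigenline», now by name. THEOREMS ONLY; no definition, no named
fact, no `sorry`. BSD is not proved by any of this; no summit statement is proved by this seat.
References: [McCallumLMS1991] §3 (2)–(3); [GrossLMS1991] §9, Prop. 9.6; crux file
`Lines/borel-heegner-squeeze-H1check.md` §3.
-/

set_option autoImplicit false
-- `…BirchSwinnertonDyer.BirchSwinnertonDyer.Theorems…` is the problem's mandated namespace (D-0017).
set_option linter.dupNamespace false

noncomputable section

open scoped Classical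

namespace Summit.BirchSwinnertonDyer.BirchSwinnertonDyer.Theorems.PrintCFram.BorelKolyvaginPairing

open WeierstrassCurve NumberField IsDedekindDomain Field Literature.NumberTheory.EllipticCurves
  Literature.NumberTheory.GaloisRepresentations Literature.NumberTheory.EllipticCurves.Rank1Residual
  Summit.BirchSwinnertonDyer.BirchSwinnertonDyer.Theorems.PrintCFram.BorelHomothety

universe u v

/-! ## §1 `[x, g^τ g] = (1 + ν τ)[x, g]`: invisible and visible eigenclasses (any field, any curve, any `n`) -/

section Generic

variable {k : Type v} {K : Type u} [Field k] [Field K] [Algebra k K] (W : WeierstrassCurve k)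
variable {σ : K ≃ₐ[k] K} {τ : AlgebraicClosure K ≃+* AlgebraicClosure K}

/-- **`[x, g^τ g] = ν τ[x, g] + [x, g]`** for a `σ_*`-eigenclass `x` (`σ_* x = ν x`, `ν = ±1`), an
involutive lift `τ` of `σ` and `g ∈ Γ_{K(E[n])}` — McCallum's `φ_{(τρ)²}(c) = c^τ(ρ)… `, the
evaluation at the Frobenius of a Kolyvagin prime. [cite: McCallumLMS1991, §3 proof of Prop. 3.1] -/
theorem h1Eval_conjGalCMH_mul_eq_add_of_eigen (hτ : IsLiftOfAut σ τ) (hinv : ∀ x, τ (τ x) = x)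
    (n : ℤ) {x : galH1Torsion (W.baseChange K) n} {ν : ℤ} (hν : ν = 1 ∨ ν = -1)
    (hx : conjAct W σ n x = ν • x) {g : absoluteGaloisGroup K}
    (hg : g ∈ torsionFixing (W.baseChange K) n) :
    h1Eval (W.baseChange K) n x (hτ.conjGalCMH g * g) =
      ν • hτ.torsionMap W n (h1Eval (W.baseChange K) n x g) + h1Eval (W.baseChange K) n x g := by
  rw [h1Eval_mul _ _ _ (hτ.conjGalCMH_mem_torsionFixing W hinv _ hg),
    hτ.h1Eval_conjGalCMH_of_eigen W hinv n hν hx hg]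

/-- **INVISIBLE eigenclasses.** If every value `[x, g]` (`g ∈ Γ_{K(E[n])}`) of the `σ_*`-eigenclass
`x` (sign `ν = ±1`) is a `τ`-eigenvector of the OPPOSITE sign (`τ[x, g] = −ν[x, g]`), then
`[x, g^τ g] = 0` for EVERY `g ∈ Γ_{K(E[n])}`: the class is killed by the Frobenius of every Kolyvagin
prime. [cite: McCallumLMS1991, §3 (2)–(3)] -/
theorem h1Eval_conjGalCMH_mul_eq_zero_of_antiEigen (hτ : IsLiftOfAut σ τ) (hinv : ∀ x, τ (τ x) = x)
    (n : ℤ) {x : galH1Torsion (W.baseChange K) n} {ν : ℤ} (hν : ν = 1 ∨ ν = -1)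
    (hx : conjAct W σ n x = ν • x)
    (hvals : ∀ g ∈ torsionFixing (W.baseChange K) n,
      hτ.torsionMap W n (h1Eval (W.baseChange K) n x g) = -(ν • h1Eval (W.baseChange K) n x g))
    {g : absoluteGaloisGroup K} (hg : g ∈ torsionFixing (W.baseChange K) n) :
    h1Eval (W.baseChange K) n x (hτ.conjGalCMH g * g) = 0 := by
  rw [h1Eval_conjGalCMH_mul_eq_add_of_eigen W hτ hinv n hν hx hg, hvals g hg, smul_neg, smul_smul]
  have hνν : ν * ν = 1 := by rcases hν with rfl | rfl <;> norm_num
  rw [hνν, one_smul, neg_add_cancel]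

/-- **VISIBLE eigenclasses, matching sign.** If every value of the `σ_*`-eigenclass `x` (sign
`ν = ±1`) is a `τ`-eigenvector of the SAME sign, then `[x, g^τ g] = 2[x, g]` for `g ∈ Γ_{K(E[n])}`
(McCallum's `φ(G^±) ⊆ ℤe_±`). [cite: McCallumLMS1991, §3 proof of Prop. 3.1] -/
theorem h1Eval_conjGalCMH_mul_eq_two_zsmul_of_sameEigen (hτ : IsLiftOfAut σ τ)
    (hinv : ∀ x, τ (τ x) = x) (n : ℤ) {x : galH1Torsion (W.baseChange K) n} {ν : ℤ}
    (hν : ν = 1 ∨ ν = -1) (hx : conjAct W σ n x = ν • x)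
    (hvals : ∀ g ∈ torsionFixing (W.baseChange K) n,
      hτ.torsionMap W n (h1Eval (W.baseChange K) n x g) = ν • h1Eval (W.baseChange K) n x g)
    {g : absoluteGaloisGroup K} (hg : g ∈ torsionFixing (W.baseChange K) n) :
    h1Eval (W.baseChange K) n x (hτ.conjGalCMH g * g) = (2 : ℤ) • h1Eval (W.baseChange K) n x g := by
  rw [h1Eval_conjGalCMH_mul_eq_add_of_eigen W hτ hinv n hν hx hg, hvals g hg, smul_smul]
  have hνν : ν * ν = 1 := by rcases hν with rfl | rfl <;> norm_num
  rw [hνν, one_smul, two_zsmul]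

/-- **A value that is not anti-eigen is seen.** If some value `[x, g]` of the `σ_*`-eigenclass `x`
(sign `ν = ±1`) is NOT a `(−ν)`-eigenvector of `τ`, then `[x, g^τ g] ≠ 0` for that `g`.
[cite: McCallumLMS1991, §3 (2)–(3)] -/
theorem h1Eval_conjGalCMH_mul_ne_zero_of_not_antiEigen (hτ : IsLiftOfAut σ τ)
    (hinv : ∀ x, τ (τ x) = x) (n : ℤ) {x : galH1Torsion (W.baseChange K) n} {ν : ℤ}
    (hν : ν = 1 ∨ ν = -1) (hx : conjAct W σ n x = ν • x) {g : absoluteGaloisGroup K}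
    (hg : g ∈ torsionFixing (W.baseChange K) n)
    (hval : hτ.torsionMap W n (h1Eval (W.baseChange K) n x g) ≠ -(ν • h1Eval (W.baseChange K) n x g)) :
    h1Eval (W.baseChange K) n x (hτ.conjGalCMH g * g) ≠ 0 := by
  intro h0
  apply hval
  rw [h1Eval_conjGalCMH_mul_eq_add_of_eigen W hτ hinv n hν hx hg] at h0
  have hνν : ν * ν = 1 := by rcases hν with rfl | rfl <;> norm_num
  -- `ν τ v + v = 0 ⟹ τ v = -ν v`
  have h1 : ν • (ν • hτ.torsionMap W n (h1Eval (W.baseChange K) n x g) +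
      h1Eval (W.baseChange K) n x g) = 0 := by rw [h0, smul_zero]
  rw [smul_add, smul_smul, hνν, one_smul] at h1
  exact eq_neg_of_add_eq_zero_left h1

/-- **The visibility criterion.** For a `σ_*`-eigenclass `x` (sign `ν = ±1`): `[x, g^τ g] = 0` for
all `g ∈ Γ_{K(E[n])}` **iff** every value `[x, g]` is a `(−ν)`-eigenvector of `τ` — i.e. the
`Γ_K`-stable group of values of `x` lies inside the `(−ν)`-eigenspace of the lift of complex
conjugation. (Surjective image: only `x` with all values `0`; Borel CM prime: sibling file.)
[cite: McCallumLMS1991, §3 (2)–(3)] -/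
theorem forall_h1Eval_conjGalCMH_mul_eq_zero_iff_antiEigen (hτ : IsLiftOfAut σ τ)
    (hinv : ∀ x, τ (τ x) = x) (n : ℤ) {x : galH1Torsion (W.baseChange K) n} {ν : ℤ}
    (hν : ν = 1 ∨ ν = -1) (hx : conjAct W σ n x = ν • x) :
    (∀ g ∈ torsionFixing (W.baseChange K) n, h1Eval (W.baseChange K) n x (hτ.conjGalCMH g * g) = 0) ↔
      ∀ g ∈ torsionFixing (W.baseChange K) n,
        hτ.torsionMap W n (h1Eval (W.baseChange K) n x g) = -(ν • h1Eval (W.baseChange K) n x g) := by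
  refine ⟨fun h g hg ↦ ?_, fun h g hg ↦ h1Eval_conjGalCMH_mul_eq_zero_of_antiEigen W hτ hinv n hν hx h hg⟩
  by_contra hne
  exact h1Eval_conjGalCMH_mul_ne_zero_of_not_antiEigen W hτ hinv n hν hx hg hne (h g hg)

end Generic

/-! ## §2 The local consequence: invisible classes die at every place with Frobenius `∼ g^τ g` -/

section Local

variable {K : Type u} [Field K] [NumberField K] (W : WeierstrassCurve ℚ) [W.IsElliptic]
variable {σ : K ≃ₐ[ℚ] K} {τ : AlgebraicClosure K ≃+* AlgebraicClosure K}

/-- **Invisible classes are locally trivial at every Kolyvagin-type place.** Let `x ∈ H¹(K, E[n])`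
be a `σ_*`-eigenclass (sign `ν = ±1`) all of whose values are `(−ν)`-eigen for the involutive lift
`τ`. Let `v` be a finite place of `K` with the data of the tree's local criterion
(`mem_torsionLocalKer_iff_h1Eval_eq_zero`: a prime `𝔐` of `\bar 𝓞_v`, an arithmetic Frobenius `F`
at the prime below it, inertia acting trivially on `E[n]`, `E(K̄)[n] → E(K̄_v)[n]` onto, `x`
unramified there) whose Frobenius is a `Γ_K`-CONJUGATE OF SOME `g^τ g`, `g ∈ Γ_{K(E[n])}` — which is
what `Frob(ℓ) = Frob(∞)` gives at the place above a Kolyvagin prime (tree, Step F of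
`exists_kolyvaginPrime_gt_of_galoisElement`). Then **`x_v = 0` in `H¹(K_v, E[n])`**.
[cite: McCallumLMS1991, §3 (3)] [cite: GrossLMS1991, Prop. 9.6] -/
theorem mem_torsionLocalKer_of_antiEigen (hτ : IsLiftOfAut σ τ) (hinv : ∀ x, τ (τ x) = x)
    {n : ℤ} (hn : n ≠ 0) {x : galH1Torsion (W.baseChange K) n} {ν : ℤ} (hν : ν = 1 ∨ ν = -1)
    (hx : conjAct W σ n x = ν • x)
    (hvals : ∀ g ∈ torsionFixing (W.baseChange K) n,
      hτ.torsionMap W n (h1Eval (W.baseChange K) n x g) = -(ν • h1Eval (W.baseChange K) n x g))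
    {v : HeightOneSpectrum (𝓞 K)} {𝔐 : Ideal (HeightOneSpectrum.localAbsIntegers v)}
    (h𝔐 : 𝔐 ∈ v.localPrimesAbove) {F δ g : absoluteGaloisGroup K}
    (hF : IsArithFrobAt (𝓞 K) F (v.primeBelow (closureEmb (K := K) (v.adicCompletion K)) 𝔐))
    (hg : g ∈ torsionFixing (W.baseChange K) n) (hFg : F = δ * (hτ.conjGalCMH g * g) * δ⁻¹)
    (hI : (v.primeBelow (closureEmb (K := K) (v.adicCompletion K)) 𝔐).inertia
      (absoluteGaloisGroup K) ≤ torsionFixing (W.baseChange K) n)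
    (hsurj : Function.Surjective (torsionPointsMap (W.baseChange K) (v.adicCompletion K) n))
    (hxunr : x ∈ unramifiedKer (geomTorsion (W.baseChange K) n)
      (v.primeBelow (closureEmb (K := K) (v.adicCompletion K)) 𝔐)) :
    x ∈ (W.baseChange K).torsionLocalKer (v.adicCompletion K) n := by
  have hgg : hτ.conjGalCMH g * g ∈ torsionFixing (W.baseChange K) n :=
    mul_mem (hτ.conjGalCMH_mem_torsionFixing W hinv _ hg) hg
  have hFT : F ∈ torsionFixing (W.baseChange K) n := by
    rw [hFg]; exact (torsionFixing_normal (W.baseChange K) _).conj_mem _ hgg δ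
  rw [mem_torsionLocalKer_iff_h1Eval_eq_zero (W.baseChange K) n h𝔐 hF hFT hI
    (isOpen_torsionFixing (W.baseChange K) hn) hsurj hxunr, hFg,
    h1Eval_conj (W.baseChange K) _ _ δ hgg,
    h1Eval_conjGalCMH_mul_eq_zero_of_antiEigen W hτ hinv n hν hx hvals hg, smul_zero]

end Local

/-! ## §3 The sign `η_line` of complex conjugation on the line `W[𝔭]` (Borel CM prime) -/

section Sign

variable {A : Type} [AddCommGroup A] {p : ℕ} [hp : Fact p.Prime]

/-- **An involution of a group of prime order is `±1`.** If `L ≤ A` has prime order `p`, and the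
additive map `f` preserves `L` and is involutive on it, then `f = η` on `L` for a sign `η = ±1`
(`L` is cyclic: `f x₀ = a x₀`, `a² ≡ 1 (mod p)`). [folklore] -/
theorem exists_sign_of_involutive_of_card_prime (L : AddSubgroup A) (hL : Nat.card L = p)
    (f : A →+ A) (hf : ∀ x ∈ L, f x ∈ L) (hff : ∀ x ∈ L, f (f x) = x) :
    ∃ η : ℤ, (η = 1 ∨ η = -1) ∧ ∀ x ∈ L, f x = η • x := by
  have hpr : p.Prime := hp.out
  haveI : Finite L := Nat.finite_of_card_ne_zero (by rw [hL]; exact hpr.ne_zero)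
  -- a generator `x₀` of `L`
  obtain ⟨x₀, hx₀⟩ : ∃ x₀ : L, x₀ ≠ 0 := by
    haveI : Nontrivial L := Finite.one_lt_card_iff_nontrivial.mp (by rw [hL]; exact hpr.one_lt)
    exact exists_ne 0
  have htop := HerbrandLineRestriction.zmultiples_eq_top_of_card_prime (p := p) hL hx₀
  have hgen : ∀ x : L, ∃ j : ℤ, j • x₀ = x := fun x ↦ by
    have hx : x ∈ AddSubgroup.zmultiples x₀ := by rw [htop]; exact AddSubgroup.mem_top x
    exact AddSubgroup.mem_zmultiples_iff.mp hx
  -- `f x₀ = a • x₀`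
  obtain ⟨a, ha⟩ := hgen ⟨f x₀, hf _ x₀.2⟩
  have ha' : f (x₀ : A) = a • (x₀ : A) := by
    have := congrArg Subtype.val ha
    simpa only [AddSubgroupClass.coe_zsmul] using this.symm
  have hfx : ∀ x ∈ L, f x = a • x := by
    intro x hx
    obtain ⟨j, hj⟩ := hgen ⟨x, hx⟩
    have hjx : (j • (x₀ : A)) = x := by
      have := congrArg Subtype.val hj
      simpa only [AddSubgroupClass.coe_zsmul] using this
    rw [← hjx, map_zsmul, ha', smul_comm]
  -- `a² ≡ 1 (mod p)` from `f (f x₀) = x₀`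
  have hsq : (a * a - 1) • (x₀ : A) = 0 := by
    have h := hff _ x₀.2
    rw [ha', map_zsmul, ha', smul_smul] at h
    rw [sub_smul, one_smul, h, sub_self]
  have hsqL : (a * a - 1) • x₀ = 0 := Subtype.ext (by
    rw [AddSubgroupClass.coe_zsmul, ZeroMemClass.coe_zero]; exact hsq)
  have hdvd : (p : ℤ) ∣ a * a - 1 :=
    HerbrandLineRestriction.prime_dvd_of_zsmul_eq_zero (p := p) hL hx₀ hsqL
  have hp' : _root_.Prime (p : ℤ) := Nat.prime_iff_prime_int.mp hpr
  have hfac : a * a - 1 = (a - 1) * (a + 1) := by ring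
  rw [hfac] at hdvd
  rcases hp'.dvd_or_dvd hdvd with h1 | h1
  · refine ⟨1, Or.inl rfl, fun x hx ↦ ?_⟩
    rw [hfx x hx]
    have hc : ((a : ZMod p)) = ((1 : ℤ) : ZMod p) :=
      (ZMod.intCast_eq_intCast_iff_dvd_sub 1 a p).mpr (by simpa using h1) |>.symm
    have := HerbrandLineRestriction.zsmul_eq_zsmul_of_intCast_eq (p := p) hL hc ⟨x, hx⟩
    have := congrArg Subtype.val this
    simpa only [AddSubgroupClass.coe_zsmul] using this
  · refine ⟨-1, Or.inr rfl, fun x hx ↦ ?_⟩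
    rw [hfx x hx]
    have hc : ((a : ZMod p)) = ((-1 : ℤ) : ZMod p) :=
      (ZMod.intCast_eq_intCast_iff_dvd_sub (-1) a p).mpr (by simpa [sub_neg_eq_add] using h1) |>.symm
    have := HerbrandLineRestriction.zsmul_eq_zsmul_of_intCast_eq (p := p) hL hc ⟨x, hx⟩
    have := congrArg Subtype.val this
    simpa only [AddSubgroupClass.coe_zsmul] using this

end Sign

section Line

variable (W : WeierstrassCurve ℚ) [W.IsElliptic] (p : ℕ) [hp : Fact p.Prime]

/-- **The sign `η_line` of complex conjugation on the line `W[𝔭] = ker μ`.** For `μ ∈ End W(ℚ̄)`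
with `μ² = [m]`, `|m| = p`, and the sign rule of `√−p` (`μ(g P) = −g μ(P)` when `g √−p = −√−p`), a
complex conjugation `c₀ ∈ Γ_ℚ` preserves the line `ker μ` (order `p`) and acts on it by a SIGN:
**`c₀ P = η_line P` for all `P ∈ ker μ`, `η_line = ±1`** (`η_line = +1` iff the kernel of the
rational `p`-isogeny is real). [cite: GrossLMS1991, §9] -/
theorem exists_lineSign_of_isComplexConjugation {c₀ : absoluteGaloisGroup ℚ}
    (hc₀ : IsComplexConjugation (Rat.castHom ℝ) c₀) {s : AlgebraicClosure ℚ}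
    {μ : AddMonoid.End W.geomPoints} {m : ℤ} (hs : s ^ 2 = ((-(p : ℤ) : ℤ) : AlgebraicClosure ℚ))
    (hm : m.natAbs = p) (hμμ : ∀ P, μ (μ P) = m • P)
    (hanti : ∀ g : absoluteGaloisGroup ℚ, g • s = -s → ∀ P, μ (g • P) = -(g • μ P)) :
    ∃ η : ℤ, (η = 1 ∨ η = -1) ∧ ∀ P : W.geomPoints, μ P = 0 → c₀ • P = η • P := by
  have hpr : p.Prime := hp.out
  have hker : Nat.card (μ : W.geomPoints →+ W.geomPoints).ker = p :=
    natCard_ker_eq (μ : W.geomPoints →+ W.geomPoints) hμμ hm hpr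
      (W.natCard_geomTorsion_prime_eq_sq hpr) (exists_mem_geomTorsion_apply_ne_zero W p hμμ hm)
  set f : W.geomPoints →+ W.geomPoints := DistribSMul.toAddMonoidHom W.geomPoints c₀ with hf
  have hfapp : ∀ P, f P = c₀ • P := fun _ ↦ rfl
  have hpres : ∀ P ∈ (μ : W.geomPoints →+ W.geomPoints).ker, f P ∈ (μ : W.geomPoints →+ W.geomPoints).ker := by
    intro P hP
    rw [AddMonoidHom.mem_ker] at hP ⊢
    have hP' : μ P = 0 := hP
    rw [hfapp]
    change μ (c₀ • P) = 0
    rw [apply_smul_eq_neg_of_isComplexConjugation p hc₀ hs hanti P, hP', smul_zero, neg_zero]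
  have hinv : ∀ P ∈ (μ : W.geomPoints →+ W.geomPoints).ker, f (f P) = P := by
    intro P _
    rw [hfapp, hfapp, smul_smul, ← pow_two, hc₀.sq_eq_one, one_smul]
  obtain ⟨η, hη, hfη⟩ := exists_sign_of_involutive_of_card_prime (p := p) _ hker f hpres hinv
  exact ⟨η, hη, fun P hP ↦ by rw [← hfapp]; exact hfη P (AddMonoidHom.mem_ker.mpr hP)⟩

variable {K : Type} [Field K] [NumberField K]
variable {σ : K ≃ₐ[ℚ] K} {τ : AlgebraicClosure K ≃+* AlgebraicClosure K} {c₀ : absoluteGaloisGroup ℚ}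

omit [W.IsElliptic] hp in
/-- **`η_line` on `W(K̄)[n]`.** Transport: if `c₀` acts on `ker μ` by `η`, then the lift
`τ = e c₀ e⁻¹` acts by `η` on every `t ∈ W(K̄)[n]` with `μ(θ⁻¹ t) = 0`
(`θ = RatClosure.torsionEquiv`). [folklore] -/
theorem torsionMap_eq_lineSign_smul (hτ : IsLiftOfAut σ τ)
    (hγ : ∀ x, τ x = absGaloisTransport (K := ℚ) (L := K) c₀ x)
    {μ : AddMonoid.End W.geomPoints} {η : ℤ}
    (hη : ∀ P : W.geomPoints, μ P = 0 → c₀ • P = η • P) (n : ℤ)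
    (t : geomTorsion (W.baseChange K) n)
    (ht : μ ((RatClosure.torsionEquiv (K := K) W n).symm t : W.geomTorsion n) = 0) :
    hτ.torsionMap W n t = η • t := by
  set θ := RatClosure.torsionEquiv (K := K) W n with hθ
  set t₀ := θ.symm t with ht₀
  have htt₀ : t = θ t₀ := (θ.apply_symm_apply t).symm
  rw [htt₀, ← RatClosure.torsionEquiv_smul_of_lift W hτ c₀ hγ n t₀, ← map_zsmul]
  congr 1
  apply Subtype.ext
  change c₀ • (t₀ : W.geomPoints) = ((η • t₀ : W.geomTorsion n) : W.geomPoints)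
  rw [AddSubgroupClass.coe_zsmul]
  exact hη _ ht

/-- **On the second layer `W[𝔭²] = W[p]` complex conjugation is NOT a scalar.** For the lift `τ`
and any sign `ν = ±1` there is `t ∈ W(K̄)[p^M]` killed by `μ²` (i.e. `p`-torsion) with
`τ t ≠ −ν t`: otherwise `τ` would be the scalar `−ν` on `W[p]`, but `√−p` maps a `(−ν)`-eigenvector
`θ u` (`μ u ≠ 0`) to the `ν`-eigenvector `θ(μ u)` (w2 g5 `torsionMap_mu_eq_neg_of_eigen`), and `2`
is invertible on `W[p^M]`. [cite: McCallumLMS1991, §3 (E^±)] -/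
theorem exists_torsionMap_ne_neg_smul_of_layer_two (hτ : IsLiftOfAut σ τ)
    (hγ : ∀ x, τ x = absGaloisTransport (K := ℚ) (L := K) c₀ x)
    (hc₀ : IsComplexConjugation (Rat.castHom ℝ) c₀) {s : AlgebraicClosure ℚ}
    {μ : AddMonoid.End W.geomPoints} {m : ℤ} (hs : s ^ 2 = ((-(p : ℤ) : ℤ) : AlgebraicClosure ℚ))
    (hm : m.natAbs = p) (hμμ : ∀ P, μ (μ P) = m • P)
    (hanti : ∀ g : absoluteGaloisGroup ℚ, g • s = -s → ∀ P, μ (g • P) = -(g • μ P))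
    (hp2 : p ≠ 2) {M : ℕ} (hM : 1 ≤ M) {ν : ℤ} (hν : ν = 1 ∨ ν = -1) :
    ∃ t : geomTorsion (W.baseChange K) ((p ^ M : ℕ) : ℤ),
      (μ ^ 2) ((RatClosure.torsionEquiv (K := K) W ((p ^ M : ℕ) : ℤ)).symm t :
        W.geomTorsion ((p ^ M : ℕ) : ℤ)) = 0 ∧
      hτ.torsionMap W ((p ^ M : ℕ) : ℤ) t ≠ -(ν • t) := by
  have hpr : p.Prime := hp.out
  set n : ℤ := ((p ^ M : ℕ) : ℤ) with hn
  set θ := RatClosure.torsionEquiv (K := K) W n with hθ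
  -- `u ∈ W[p] ⊆ W[p^M]` with `μ u ≠ 0`
  obtain ⟨u₀, hu₀p, hu₀⟩ := exists_mem_geomTorsion_apply_ne_zero W p hμμ hm
  have hpn : (p : ℤ) ∣ n := by rw [hn, Nat.cast_pow]; exact dvd_pow_self _ (by omega)
  have hu₀n : u₀ ∈ W.geomTorsion n := W.geomTorsion_le_of_dvd hpn hu₀p
  -- `μ² v = m v = 0` for `v ∈ W[p]`
  have hμ2 : ∀ v : W.geomPoints, v ∈ W.geomTorsion (p : ℤ) → (μ ^ 2) v = 0 := by
    intro v hv
    rw [pow_two, AddMonoid.End.coe_mul, Function.comp_apply, hμμ]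
    have hv' : (p : ℤ) • v = 0 := (mem_geomTorsion_iff W (p : ℤ) v).mp hv
    rcases Int.natAbs_eq m with h | h
    · rw [h, hm]; exact hv'
    · rw [h, hm, neg_smul, hv', neg_zero]
  by_contra hall
  push Not at hall
  -- `t := θ u` is `(−ν)`-eigen
  set u : W.geomTorsion n := ⟨u₀, hu₀n⟩ with hu
  have hθu : θ.symm (θ u) = u := θ.symm_apply_apply u
  have ht : hτ.torsionMap W n (θ u) = (-ν) • θ u := by
    rw [neg_smul]; exact hall (θ u) (by rw [hθu]; exact hμ2 u₀ hu₀p)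
  -- hence `θ (μ u)` is `ν`-eigen (the swap) …
  have hswap := torsionMap_mu_eq_neg_of_eigen W p hτ hγ hc₀ hs hanti n (θ u) ht
  rw [neg_smul, neg_neg] at hswap
  -- … and also `(−ν)`-eigen, being `p`-torsion
  have hμu_p : μ (u₀ : W.geomPoints) ∈ W.geomTorsion (p : ℤ) :=
    apply_mem_torsionBy (μ : W.geomPoints →+ W.geomPoints) hu₀p
  set w : geomTorsion (W.baseChange K) n :=
    θ ⟨μ ((θ.symm (θ u) : W.geomTorsion n) : W.geomPoints),
      apply_mem_geomTorsion W (θ.symm (θ u)).2⟩ with hw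
  have hw' : hτ.torsionMap W n w = -(ν • w) := by
    refine hall w ?_
    rw [hw, θ.symm_apply_apply]
    change (μ ^ 2) (μ ((θ.symm (θ u) : W.geomTorsion n) : W.geomPoints)) = 0
    rw [hθu]
    exact hμ2 _ hμu_p
  -- `ν w = -ν w ⟹ 2 w = 0 ⟹ w = 0 ⟹ μ u₀ = 0`
  have h2 : (2 : ℤ) • (ν • w) = 0 := by
    rw [two_zsmul]
    nth_rewrite 1 [← hswap]
    rw [hw', neg_add_cancel]
  obtain ⟨u', hu'⟩ := exists_two_mul_zsmul_eq_of_odd (W.baseChange K) (n := p ^ M)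
    ((hpr.odd_of_ne_two hp2).pow)
  have hw0 : ν • w = 0 := by
    rw [← hu' (ν • w), mul_comm, mul_zsmul, h2, zsmul_zero]
  have hw00 : w = 0 := by
    rcases hν with rfl | rfl
    · rwa [one_smul] at hw0
    · rwa [neg_one_zsmul, neg_eq_zero] at hw0
  apply hu₀
  have := congrArg (fun x : W.geomTorsion n => (x : W.geomPoints)) (θ.map_eq_zero_iff.mp hw00)
  simpa [hθu] using this

end Line

end Summit.BirchSwinnertonDyer.BirchSwinnertonDyer.Theorems.PrintCFram.BorelKolyvaginPairing

end
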